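import Literature.AnabelianGeometry.EtaleTheta.SettingModelTateThetaEnv
import Literature.AnabelianGeometry.EtaleTheta.SettingModelTateDeckDisplayNegOne
import Literature.AnabelianGeometry.EtaleTheta.SettingModelTateProp15
import Literature.AnabelianGeometry.EtaleTheta.SettingModelTateKummerDataFiltration
import Literature.AnabelianGeometry.EtaleTheta.Discharge.Sec1Prop15OfYCoordKit
import HarnessLib

/-!
# [EtTh] §2 over §1 AT THE TATE INSTANCE `ThetaSetting.modelTate p = modelχq p 1 2`: THE RIGIDITY DATA OF RECORD
# with Prop. 1.5 (iii) DISCHARGED — the §1 root package Prop. 1.3 ∧ 1.5 (i) ∧ (ii) ∧ (iii) and the §2 rows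
# Prop. 2.12 (i)(ii), 2.14 (i)(iii), Cor. 2.18 (iii)(iv) TRUE at ONE closed kernel inhabitant (proof-only capstone)

Mochizuki, *The Étale Theta Function and its Frobenioid-theoretic Manifestations* [EtTh], Publ. RIMS **45** (2009), §1
Prop. 1.3 p. 20, Prop. 1.5 (i)–(iii) p. 23; §2 Def. 2.13 p. 47, Prop. 2.12 p. 45, Prop. 2.14 p. 49, Cor. 2.18 pp. 59–63,
Cor. 2.19 p. 64 [cite: MochizukiEtTh2009, Prop 2.14 (i) p.49].  Cell `abc-iut`, layer L2, seat abc-iut-L2-t8 (gen 6; owner of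
the §1 → §2 merge adapter `C.rigidData` / `C.thetaEnvData` / `C.thetaEnvTower`); R78 cluster STAGE 2 (integrator
abc-iut-L6-d6), row #5 — §3 (the CLOSED instance) of this seat's `SettingModelTateThetaEnv` (p444774).  PROOF-ONLY: no
definition, no instance, no notation, no new named fact; nothing of another seat is edited or restated — BY NAME.

INPUTS OF RECORD (all kernel objects at the stage-2 «Tate shear» model `modelχq p 1 2 even_two`):
* the Kummer core `kummerCoreχq` (abc-iut-w5-d171 F6q) with its coordinate kit `yCoordKitχq` (`ŷ` dies on `Δ_Θ`,
  abc-iut-w5-d181 `yCoordKitχq_y_eq_one_of_mem_deltaTheta`) and the `z`-lift of `log(Θ)` (abc-iut-L6-d5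
  `exists_res_eq_logTheta_gtpY_modelχq`) ⇒ Prop. 1.5 (i), (ii) for the section datum `K_s := kummerCoreχq.toKummerDataOfSection s`
  of EVERY continuous Galois section `s` (abc-iut-w5-d140 / L6-d5 `KummerCore.prop15i_and_prop15ii_ofSection_of_kit`);
* the class of record `η̈♯ = etaDdχq` (abc-iut-L2-t6 F7q) and **Prop. 1.5 (iii) for `E_s := K_s.etaleThetaDataOfClass η̈♯`,
  UNCONDITIONAL** (abc-iut-L2-t6 `prop15iii_etaleThetaDataOfClass_etaDdχq`, `SettingModelTateDeckDisplayNegOne`; the Kummer-side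
  engine is abc-iut-L2-t12's); Prop. 1.3 by `prop13_etaleThetaDataOfClass`;
* the choice `X̲̲ := E_s.doubleUnderlineχqOfEtaRes … (eta_res_etaDdχq …)` (abc-iut-L2-d1), cyclotomes `μ` (this seat, p437770),
  `Compat` / `Sec2Hyps` / temp-slimness / `IsOpenMap aug` / `IsEtThOrigin` / `hYcl` (abc-iut-f-149 g3's `Sec2RigidityAtModelTate`
  discharges, over abc-iut-L2-t5 / L2-d1 / w5-d249), and §2 of `SettingModelTateThetaEnv` (`rigidData_modelχqSec_sec2_rows`);

RESULTS, for EVERY Galois section `s`: `prop13_prop15_sectionData_modelTate` (Prop. 1.3 ∧ 1.5 (i) ∧ (ii) ∧ (iii) at `E_s`);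
**`rigidData_modelTateSec_sec2_rows`** — the EIGHT `RigidData` rows (F-1920 Prop212_i, F-0630 Prop212_ii, F-0631 Prop214_i,
F-0624 Cor218_iv_fibre, F-0622/F-0623 Cor218_iii, F-0634/F-0633 Prop214_iii mono/bi at the empty labelling) TRUE for
`X̲̲.rigidData μ compat sec2Hyps h15 L∅` with `h15` DISCHARGED — binders = the section `s` and the level `μ` only; Cor. 2.19 (i)
modulo Cor. 2.18 (i); `exists_rigidData_sec2_rows_modelTate_of_section` — the census form whose ONLY hypotheses are the
section data `(s, hs, hsec, hsY, hsYdd)` (sections exist, e.g. the Galois factor `inr` — abc-iut-L6-d5's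
`SettingModelTateProp15ii`, pending at filing time; the hypothesis-free form `exists_rigidData_sec2_rows_modelTate` is the
one-line sequel `SettingModelTateRigidityOfRecordClosed` filed when that parent lands).  At any section this is a kernel
inhabitant of `RigidData N l` produced by the §1 → §2 adapter from §1 data satisfying the WHOLE typed §1 root package, with
the universally-REFUTED-over-the-lawless-interface §2 rows (abc-iut-w5-d175's toys) TRUE at it.
HONEST LABEL: `modelχq` is a SEMI-SYNTHETIC model of the typed §1 interface (not the tempered `π₁` of a curve, no theta
FUNCTION) — consistency / joint-satisfiability evidence only; nothing of [EtTh] asserted; no side taken on [IUTchIII]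
Cor. 3.12; typed ≠ proved; FACT rows are assumption labels, not endorsements.
-/

noncomputable section

namespace Literature.AnabelianGeometry.EtaleTheta.SettingModel

open Literature.AnabelianGeometry.SemiGraphs

variable (p : ℕ) [Fact p.Prime] (l : ℕ+) (hl : Odd (l : ℕ)) {N : ℕ+}
  (μ : (ThetaSetting.modelχq p 1 2 even_two).CyclotomeMod l N)
  (s : GQp p →* (ThetaSetting.modelχq p 1 2 even_two).PiTemp) (hs : Continuous s)
  (hsec : ∀ σ : GQp p, (ThetaSetting.modelχq p 1 2 even_two).aug (s σ) = σ)
  (hsY : (ThetaSetting.modelχq p 1 2 even_two).GK.map s ≤ (ThetaSetting.modelχq p 1 2 even_two).GtpY)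
  (hsYdd : (ThetaSetting.modelχq p 1 2 even_two).GKdd.map s ≤ (ThetaSetting.modelχq p 1 2 even_two).GtpYdd)

/-! ## Every Galois section `s`: the §1 root package and the §2 rows at the rigidity data of record -/

/-- **Prop. 1.3 ∧ Prop. 1.5 (i) ∧ (ii) ∧ (iii) at ONE étale-theta datum of the Tate instance** — the section datum of ANY
continuous Galois section `s` carrying the class of record `η̈♯`: Prop. 1.3 by construction (`prop13_etaleThetaDataOfClass`),
(i)/(ii) by the coordinate kit + the `z`-lift (abc-iut-w5-d140 / L6-d5 / w5-d181), (iii) by abc-iut-L2-t6's F7q theorem.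
[cite: MochizukiEtTh2009, Prop 1.5 (iii) p.23] -/
theorem prop13_prop15_sectionData_modelTate (hC : (ThetaSetting.modelχq p 1 2 even_two).Compat) :
    ThetaSetting.Prop13 (((kummerCoreχq p 1 2 even_two).toKummerDataOfSection s hs hsec hsY hsYdd).etaleThetaDataOfClass
        (etaDdχq p 1 2 even_two)) ∧
      ThetaSetting.Prop15i ((kummerCoreχq p 1 2 even_two).toKummerDataOfSection s hs hsec hsY hsYdd) hC ∧
      ThetaSetting.Prop15ii ((kummerCoreχq p 1 2 even_two).toKummerDataOfSection s hs hsec hsY hsYdd) hC ∧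
      ThetaSetting.Prop15iii (((kummerCoreχq p 1 2 even_two).toKummerDataOfSection s hs hsec hsY hsYdd).etaleThetaDataOfClass
        (etaDdχq p 1 2 even_two)) hC := by
  haveI : T2Space (ThetaSetting.modelχq p 1 2 even_two).GtpTheta := CurveTheta.t2Space_GTheta (curveχq p 1 2)
  obtain ⟨x, hx⟩ := exists_res_eq_logTheta_gtpY_modelχq p 1 2 even_two
    (hC.deltaTheta_le_DtpYTheta.trans (Subgroup.map_mono inf_le_left))
  obtain ⟨h15i, h15ii⟩ := (kummerCoreχq p 1 2 even_two).prop15i_and_prop15ii_ofSection_of_kit (yCoordKitχq p 1 2 even_two)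
    s hs hsec hsY hsYdd hC rfl rfl (yCoordKitχq_y_eq_one_of_mem_deltaTheta p 1 2 even_two) x hx
  exact ⟨ThetaSetting.KummerData.prop13_etaleThetaDataOfClass _ _, h15i, h15ii,
    prop15iii_etaleThetaDataOfClass_etaDdχq p hC s hs hsec hsY hsYdd⟩

/-- **The EIGHT `RigidData` rows at the Tate instance's rigidity data of record, Prop. 1.5 (iii) DISCHARGED** (F-1920,
F-0630, F-0631, F-0624, F-0622, F-0623, F-0634/F-0633 at the empty labelling): for every Galois section `s` and level `μ`,
`X̲̲.rigidData μ compat sec2Hyps h15 L∅` with `h15 :=` abc-iut-L2-t6's theorem satisfies Prop. 2.12 (i), (ii), Prop. 2.14 (i),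
Cor. 2.18 (iv) fibre, Cor. 2.18 (iii) (both), Prop. 2.14 (iii) mono, bi — NO binder beyond `s`, `μ`.
[cite: MochizukiEtTh2009, Prop 2.14 (i) p.49] -/
theorem rigidData_modelTateSec_sec2_rows :
    let K := (kummerCoreχq p 1 2 even_two).toKummerDataOfSection s hs hsec hsY hsYdd
    let h15 := prop15iii_etaleThetaDataOfClass_etaDdχq p (compat_modelχq p 1 2 even_two) s hs hsec hsY hsYdd
    let R := ((K.etaleThetaDataOfClass (etaDdχq p 1 2 even_two)).doubleUnderlineχqOfEtaRes p 1 2 l hl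
        (eta_res_etaDdχq p 1 2 even_two l hl)).rigidData μ (compat_modelχq p 1 2 even_two)
        (ThetaSetting.modelχq_sec2Hyps p 1 2 even_two) h15 ⟨fun _ => ∅, fun _ => ∅, fun _ => rfl⟩
    Literature.AnabelianGeometry.EtaleTheta.RigidData.Prop212_i R ∧
      Literature.AnabelianGeometry.EtaleTheta.RigidData.Prop212_ii R ∧
      Literature.AnabelianGeometry.EtaleTheta.RigidData.Prop214_i R ∧
      Literature.AnabelianGeometry.EtaleTheta.RigidData.Cor218_iv_fibre R ∧
      Literature.AnabelianGeometry.EtaleTheta.RigidData.Cor218_iii_PiX R ∧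
      Literature.AnabelianGeometry.EtaleTheta.RigidData.Cor218_iii_quotient R ∧
      Literature.AnabelianGeometry.EtaleTheta.RigidData.Prop214_iii_mono R ∧
      Literature.AnabelianGeometry.EtaleTheta.RigidData.Prop214_iii_bi R :=
  rigidData_modelχqSec_sec2_rows p 1 2 even_two l hl _ μ _

/-- **Cor. 2.19 (i) at the Tate instance's rigidity data of record** (subquotients ∧ cyclotomic rigidity), modulo
Cor. 2.18 (i) at that data ONLY — Prop. 1.5 (iii) discharged. [cite: MochizukiEtTh2009, Cor 2.19 (i) p.64] -/
theorem rigidData_modelTateSec_cor219_i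
    (h218i : (((((kummerCoreχq p 1 2 even_two).toKummerDataOfSection s hs hsec hsY hsYdd).etaleThetaDataOfClass
        (etaDdχq p 1 2 even_two)).doubleUnderlineχqOfEtaRes p 1 2 l hl (eta_res_etaDdχq p 1 2 even_two l hl)).rigidData μ
        (compat_modelχq p 1 2 even_two) (ThetaSetting.modelχq_sec2Hyps p 1 2 even_two)
        (prop15iii_etaleThetaDataOfClass_etaDdχq p (compat_modelχq p 1 2 even_two) s hs hsec hsY hsYdd)
        ⟨fun _ => ∅, fun _ => ∅, fun _ => rfl⟩).Cor218_i) :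
    let K := (kummerCoreχq p 1 2 even_two).toKummerDataOfSection s hs hsec hsY hsYdd
    let h15 := prop15iii_etaleThetaDataOfClass_etaDdχq p (compat_modelχq p 1 2 even_two) s hs hsec hsY hsYdd
    let R := ((K.etaleThetaDataOfClass (etaDdχq p 1 2 even_two)).doubleUnderlineχqOfEtaRes p 1 2 l hl
        (eta_res_etaDdχq p 1 2 even_two l hl)).rigidData μ (compat_modelχq p 1 2 even_two)
        (ThetaSetting.modelχq_sec2Hyps p 1 2 even_two) h15 ⟨fun _ => ∅, fun _ => ∅, fun _ => rfl⟩
    Literature.AnabelianGeometry.EtaleTheta.RigidData.Cor219_i_subquotients R ∧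
      Literature.AnabelianGeometry.EtaleTheta.RigidData.Cor219_i_splittings R :=
  rigidData_modelχqSec_cor219_i p 1 2 even_two l hl _ μ _ h218i

include hl hs hsec hsY hsYdd in
/-- **CENSUS at the Tate instance, modulo the choice of a Galois section `s` only** (sections exist: `inr`, sequel): there
EXIST an étale-theta datum `E` with `η̈^Θ = η̈♯`, Prop. 1.3, Prop. 1.5 (i), (ii), (iii), a choice `X̲̲` with
`Π^tp_X̲̲ = Huuχq`, a level-`N` cyclotome identification and a cusp labelling for which ALL EIGHT `RigidData` rows hold.
[cite: MochizukiEtTh2009, Prop 2.14 (i) p.49] -/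
theorem exists_rigidData_sec2_rows_modelTate_of_section (N : ℕ+) :
    ∃ (E : (ThetaSetting.modelχq p 1 2 even_two).EtaleThetaData) (C : E.DoubleUnderline l)
      (μ : (ThetaSetting.modelχq p 1 2 even_two).CyclotomeMod l N)
      (h15 : ThetaSetting.Prop15iii E (compat_modelχq p 1 2 even_two)) (L : C.CuspLabels),
      E.etaDd = etaDdχq p 1 2 even_two ∧ ThetaSetting.Prop13 E ∧
      ThetaSetting.Prop15i E.toKummerData (compat_modelχq p 1 2 even_two) ∧
      ThetaSetting.Prop15ii E.toKummerData (compat_modelχq p 1 2 even_two) ∧ C.Huu = Huuχq p 1 2 l hl ∧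
      Literature.AnabelianGeometry.EtaleTheta.RigidData.Prop212_i
          (C.rigidData μ (compat_modelχq p 1 2 even_two) (ThetaSetting.modelχq_sec2Hyps p 1 2 even_two) h15 L) ∧
      Literature.AnabelianGeometry.EtaleTheta.RigidData.Prop212_ii
          (C.rigidData μ (compat_modelχq p 1 2 even_two) (ThetaSetting.modelχq_sec2Hyps p 1 2 even_two) h15 L) ∧
      Literature.AnabelianGeometry.EtaleTheta.RigidData.Prop214_i
          (C.rigidData μ (compat_modelχq p 1 2 even_two) (ThetaSetting.modelχq_sec2Hyps p 1 2 even_two) h15 L) ∧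
      Literature.AnabelianGeometry.EtaleTheta.RigidData.Cor218_iv_fibre
          (C.rigidData μ (compat_modelχq p 1 2 even_two) (ThetaSetting.modelχq_sec2Hyps p 1 2 even_two) h15 L) ∧
      Literature.AnabelianGeometry.EtaleTheta.RigidData.Cor218_iii_PiX
          (C.rigidData μ (compat_modelχq p 1 2 even_two) (ThetaSetting.modelχq_sec2Hyps p 1 2 even_two) h15 L) ∧
      Literature.AnabelianGeometry.EtaleTheta.RigidData.Cor218_iii_quotient
          (C.rigidData μ (compat_modelχq p 1 2 even_two) (ThetaSetting.modelχq_sec2Hyps p 1 2 even_two) h15 L) ∧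
      Literature.AnabelianGeometry.EtaleTheta.RigidData.Prop214_iii_mono
          (C.rigidData μ (compat_modelχq p 1 2 even_two) (ThetaSetting.modelχq_sec2Hyps p 1 2 even_two) h15 L) ∧
      Literature.AnabelianGeometry.EtaleTheta.RigidData.Prop214_iii_bi
          (C.rigidData μ (compat_modelχq p 1 2 even_two) (ThetaSetting.modelχq_sec2Hyps p 1 2 even_two) h15 L) := by
  obtain ⟨μ⟩ := modelχq_nonempty_cyclotomeMod p 1 2 even_two l.pos N
  obtain ⟨h13, h15i, h15ii, h15iii⟩ := prop13_prop15_sectionData_modelTate p s hs hsec hsY hsYdd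
    (compat_modelχq p 1 2 even_two)
  exact ⟨_, _, μ, h15iii, _, rfl, h13, h15i, h15ii, rfl, rigidData_modelTateSec_sec2_rows p l hl μ s hs hsec hsY hsYdd⟩

end Literature.AnabelianGeometry.EtaleTheta.SettingModel

end
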